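import Summits.ResolutionOfSingularities.ResolutionOfSingularities.Theses.SyzygyFlattening
import Summits.ResolutionOfSingularities.ResolutionOfSingularities.Theorems.SyzygyFlatteningDefs
import Summits.ResolutionOfSingularities.ResolutionOfSingularities.Theorems.SyzygyFlatteningHigherRankTerminationTowerLocalisation
import Summits.ResolutionOfSingularities.ResolutionOfSingularities.Theorems.SyzygyFlatteningGlobalisationClosedPointDimZero
import Summits.ResolutionOfSingularities.ResolutionOfSingularities.Theorems.SyzygyFlatteningGlobalisationCentreChart
import Summits.ResolutionOfSingularities.ResolutionOfSingularities.Theorems.SyzygyFlatteningGlobalisationRegCentreOpen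
import Summits.ResolutionOfSingularities.ResolutionOfSingularities.Theorems.SyzygyFlatteningGlobalisationRegCentreGeneric
import Literature.AlgebraicGeometry.Resolution.ProperModels
import Literature.AlgebraicGeometry.Resolution.ZariskiFiniteness
import HarnessLib

/-!
# `SyzygyFlattening.Globalisation` (crux stmt-ResolutionOfSingularities-17061), line `birth`:
# TOWER COMPACTNESS

Route `ResolutionOfSingularities/SyzygyFlattening`, crux #4 `Globalisation`. The birth skeleton cut the
crux into ONE TOWER (a `RegLe` tower of proper models whose local rings at centres of valuations are the
verbatim syzygy-flattening tower rings) and TOWER COMPACTNESS, proved here: for ANY tower of proper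
models `⋯ → N₁ → N₀ → M` of `K/k` with `RegLe` transitions (`φ⁻¹(Reg N_m) ⊆ Reg N_(m+1)`) on which every
DIMENSION-ZERO valuation ring of `K/k` has a regular centre at SOME stage, `M` has a resolution of
singularities.

Proof (Zariski–Samuel II, Ch. VI §17): the loci `U_m = {v ∈ Zar(K/k) : centre of v on N_m regular}` are
open (`stub_regCentreOpen`, landed), increase with `m` (`RegCentre.of_hom` from `RegLe`) and cover
`Zar(K/k)` — every `w` specialises to a closed point `v ≤ w` (`ZariskiRiemannSpace.exists_le_isClosed`),
which is dimension-zero (`stub_closedPointDimZero`, landed) and regular centres generise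
(`stub_regCentreGeneric`, landed); Zariski's compactness theorem (`ZariskiRiemannSpace.compactSpace`)
gives ONE `m` with `U_m = Zar(K/k)`, so `N_m` is regular (`isRegular_of_forall_regCentre`) and
`N_m → M` is a resolution (`Hom.hasResolution`).

No definitions are introduced.
-/

noncomputable section

-- single-problem summit: the doubled namespace component `ResolutionOfSingularities` is forced
set_option linter.dupNamespace false

namespace Summit.ResolutionOfSingularities.ResolutionOfSingularities.Theorems.SyzygyFlattening

open CategoryTheory AlgebraicGeometry TopologicalSpace
open Literature.AlgebraicGeometry
open Literature.AlgebraicGeometry.Resolution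

variable {k K : Type} [Field k] [Field K] [Algebra k K]

/-- Every stage of a tower `⋯ → N 1 → N 0 → M` dominates `M` (composite of the transitions). [folklore] -/
theorem globalisation_nonempty_towerHom {M : ProperModel k K} (N : ℕ → ProperModel k K)
    (φ : ∀ m, (N (m + 1)).Hom (N m)) (ψ : (N 0).Hom M) : ∀ m, Nonempty ((N m).Hom M)
  | 0 => ⟨ψ⟩
  | m + 1 => by
    obtain ⟨χ⟩ := globalisation_nonempty_towerHom N φ ψ m
    exact ⟨(φ m).comp χ⟩

/-- **TOWER COMPACTNESS** (birth skeleton's `stub_towerCompactness`, now a theorem): a `RegLe` tower of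
proper models over `M` on which every dimension-zero valuation ring has a regular centre at some stage
resolves `M` (Zariski compactness of `Zar(K/k)` + openness, monotonicity and generisation of the
regular-centre loci). [cite: ZariskiSamuel1960, Ch. VI §17, Thm. 40] -/
theorem globalisation_towerCompactness (M : ProperModel k K) (N : ℕ → ProperModel k K)
    (φ : ∀ m, (N (m + 1)).Hom (N m)) (ψ : (N 0).Hom M) (hφ : ∀ m, (φ m).RegLe)
    (hcov : ∀ v : ZariskiRiemannSpace k K, DimZero k v.asValuationSubring → ∃ m, (N m).RegCentre v) :
    Scheme.HasResolution M.X := by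
  classical
  let U : ℕ → Set (ZariskiRiemannSpace k K) := fun m => {v | (N m).RegCentre v}
  have hUo : ∀ m, IsOpen (U m) := fun m => stub_regCentreOpen stub_centreChart k K (N m)
  have hstep : ∀ m v, v ∈ U m → v ∈ U (m + 1) := fun m v hv =>
    ProperModel.RegCentre.of_hom (φ m) (hφ m) hv
  have hmono : ∀ {m m' : ℕ}, m ≤ m' → U m ⊆ U m' := by
    intro m m' hle v hv
    induction hle with
    | refl => exact hv
    | step _ ih => exact hstep _ v ih
  have hcover : ∀ w : ZariskiRiemannSpace k K, ∃ m, w ∈ U m := by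
    intro w
    obtain ⟨v, hvw, hvc⟩ := ZariskiRiemannSpace.exists_le_isClosed w
    obtain ⟨m, hm⟩ := hcov v (stub_closedPointDimZero k K v hvc)
    exact ⟨m, stub_regCentreGeneric stub_centreChart k K (N m) v w hvw hm⟩
  obtain ⟨t, ht⟩ := isCompact_univ.elim_finite_subcover U hUo
    (fun w _ => Set.mem_iUnion.mpr (hcover w))
  let m₀ : ℕ := t.sup id
  have hall : ∀ v : ZariskiRiemannSpace k K, (N m₀).RegCentre v := by
    intro v
    have hv : v ∈ ⋃ m ∈ t, U m := ht (Set.mem_univ v)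
    obtain ⟨m, hmt, hvm⟩ := Set.mem_iUnion₂.mp hv
    have hle : m ≤ m₀ := Finset.le_sup (f := id) hmt
    exact hmono hle hvm
  obtain ⟨χ⟩ := globalisation_nonempty_towerHom N φ ψ m₀
  exact χ.hasResolution (ProperModel.isRegular_of_forall_regCentre hall)

end Summit.ResolutionOfSingularities.ResolutionOfSingularities.Theorems.SyzygyFlattening

end
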